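/-
Copyright (c) 2026 the pub-hodgecm-mathlib formalisation cell (harness21).  Prover seat hodgecm-mathlib-K2E1-p12 (g6), Track B ∕ K2-LIT, h413 = `stmt-HodgeConjecture-24833`,
R90-TF section S8 «ContSpec-n½», ESTATE T (S8 dealer R90-CS-plan (g3) S8-R199 J-S8-ADM′, S8-R203, S8-R204 J-S8-T1, S8-R205 (1)): the LAWS LAYER (file 1 of 2) over the τ-DEFS of record
★ `R90S8ResGMidAtomTauU3Defs` (typed by R90-CS-typ2 (g3), ★ p864157) — arch-finiteness of sections at levels containing `ι(K_∞)` and the junction «atoms at such levels ⊆ τ-atoms».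
File 2 `R90S8ResGMidAtomTauLawsKMaxU3`: finite-dimensionality of the `K_max`-translate span at a τ-level and the `archFin` reduction.
-/
import Summits.HodgeConjecture.HodgeConjecture.Theorems.R90S8ResGMidAtomTauU3Defs          -- ★ p864157 τ-DEFS (typed by R90-CS-typ2): `IsTauLevel`, `tauLevel`, `archMaximalCompact`, `archTranslateSpan`, `IsArchFinite`, `resGMidAtomGenτ`, `resGMidAtomτ`, `resGMidBlockτ` + read-backs
import Summits.HodgeConjecture.HodgeConjecture.Theorems.R90S8ChiSectionPairLevelOfRecordU3   -- ★ p863976 (K2E1-p11): `levelOfRecord`∕`omegaOfRecord` API (`archToAdelic_mem_levelOfRecord`, `exists_mem_levelOfRecord_omegaOfRecord_eq_one`)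
import Mathlib.LinearAlgebra.FiniteDimensional.Basic                                         -- Mathlib `Submodule.finiteDimensional_of_le`
import HarnessLib

/-!
# R90-TF · S8 «ContSpec-n½» — `R90S8ResGMidAtomTauLawsU3`: LAWS OF THE τ-ADMISSIBLE GENERATOR PACKAGE (ESTATE T), FILE 1 — ARCH-FINITENESS AT LEVELS CONTAINING `ι(K_∞)`, AND
# «ATOMS AT SUCH LEVELS ⊆ τ-ATOMS» (in particular at the LEVEL OF RECORD)

Cell `hodgecm-mathlib`, crux H413 (`stmt-HodgeConjecture-24833`, lane `--supports … --as helper`), route of record `HCCMUnconditional`; R90-TF section S8, (R)′∕(V)∕(E) roads in the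
τ-ADMISSIBLE wording of S8-R199 (J-S8-ADM′).  THEOREMS ONLY (no `def`, no `instance`, no `notation`, no named-fact hypothesis, no `sorry`; default heartbeats); count-neutral; CLOSES NO
SOCKET.  Vocabulary = the τ-defs BY NAME (`IsTauLevel U₀`, `tauLevel U₀ = ι_f(U₀)`, `archMaximalCompact = ι(K_∞)`, `archTranslateSpan φ = span {r(k)φ | k ∈ ι(K_∞)}`, `IsArchFinite φ`,
`resGMidAtomGenτ ∕ resGMidAtomτ ∕ resGMidBlockτ`) and ★ `levelOfRecord ∕ omegaOfRecord` (p863976).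

THE MATHEMATICS ([BorelJacquet1979, §1.3, §4.1, §4.2]; [MoeglinWaldspurger1995, I.2.17, II.1]; [Rogawski1990, §13.9 (ii)]; [WallachRRG1, §3.3.1]).
* §0 `rightTranslation_mul_apply` (`r(xy)φ = r(x)(r(y)φ)`), `rightTranslation_eq_of_eq_mul` (`x = y·u`, `r(u)φ = φ ⇒ r(x)φ = r(y)φ`).
* §1 L-ARCH.  If the level `K′` CONTAINS `ι(K_∞)` then every `φ ∈ V(χ₁, χ₂; K′, ω)` is a `K_∞`-EIGENSECTION, `r(k)φ = ω(k)·φ` (`rightTranslation_eq_smul_of_mem`), so `archTranslateSpan φ ≤ ℂ·φ` and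
  `φ` is arch-finite (**`isArchFinite_of_archMaximalCompact_le`**); the level of record `levelOfRecord K_f = {k ∈ K | k_f ∈ K_f}` contains `ι(K_∞)` (`archMaximalCompact_le_levelOfRecord`,
  ★ `archToAdelic_mem_levelOfRecord`), whence **`isArchFinite_of_mem_chiSectionSpacePair_levelOfRecord`**: THE ONE-DIMENSIONAL-`K_∞`-TYPE SECTIONS OF RECORD ARE ARCH-FINITE.
* §2 L-GEN→τ.  In the frame of the OF-RECORD files' binders `hKinf : ι(K_∞) ≤ K′` and `hU : ∀ b ∈ U₀, ι_f b ∈ K′ ∧ ω(ι_f b) = 1`: a ★ D1 generator at `(K′, ω)` IS a τ-admissible generator at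
  `U₀` — the section is re-levelled to `(tauLevel U₀, 1)` (`chiSectionSpacePair_le_tauLevel`: Borel law kept, right law from `hU`), it is arch-finite by §1, and the continuation ∕
  pole-letter ∕ a.e. clauses are carried byte for byte (**`resGMidAtomGen_subset_resGMidAtomGenτ`**); closures **`resGMidAtom_le_resGMidAtomτ`**, **`resGMidAtom_le_resGMidBlockτ`**
  (`IsTauLevel U₀`).  §2′ AT THE LEVEL OF RECORD, for any `ω₀ : levelOfRecord K_f →* ℂ` agreeing pointwise with ★ `omegaOfRecord χ₁′ χ₂′ K_f` and ANY `U₀ ≤ K_f ≤ G(𝒪̂)_f`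
  (`ω₀(ι_f b) = Φa(1) = 1`, ★ `exists_mem_levelOfRecord_omegaOfRecord_eq_one`; `hU_levelOfRecord`): **`mem_resGMidAtomGenτ_of_mem_resGMidAtomGen_levelOfRecord`**,
  **`resGMidAtom_levelOfRecord_le_resGMidAtomτ`**, **`resGMidAtom_levelOfRecord_le_resGMidBlockτ`** — «1-dim atoms ⊆ τ-atoms ⊆ τ-block».
HONEST LABEL: HC_CM is proved only modulo the 7 printed citations (2 remaining named inputs: hLiu418 = `stmt-HodgeConjecture-24832`, h413 = `stmt-HodgeConjecture-24833`) until rung 0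
closes; laws pay no socket; `hW1`∕(INV) untouched; the K-finite EXPORTS (T-FILE 2) and the shifted witness's arch-finiteness remain with their owners; REL ≠ ★ ≠ WRITTEN ≠ BUILT; count-neutral.

## References
* [BorelJacquet1979] A. Borel, H. Jacquet, *Automorphic forms and automorphic representations*, Proc. Symp. Pure Math. 33.1 (1979), §1.3 (`K`-finite functions), §4.1 (`G(𝔸) = G_∞ × G(𝔸_f)`,
  `K = K_∞·K_f`), §4.2 (smoothness = right-`U₀`-invariance, `K`-finiteness).
* [MoeglinWaldspurger1995] C. Mœglin, J.-L. Waldspurger, *Spectral Decomposition and Eisenstein Series* (1995), I.2.17 (`K`-finite induced sections), II.1.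
* [Rogawski1990] J. D. Rogawski, *Automorphic Representations of Unitary Groups in Three Variables* (1990), §13.9 (ii) p. 229.
* [WallachRRG1] N. R. Wallach, *Real Reductive Groups I* (1988), §3.3.1 (`K`-finite vectors).
-/

set_option autoImplicit false
set_option linter.dupNamespace false  -- the mandated namespace `…HodgeConjecture.HodgeConjecture.R90.S8` (LEAD #1 L1) repeats the summit's segment

noncomputable section

open MeasureTheory Measure Set Filter Topology NumberField
open Literature.NumberTheory.Automorphic Literature.NumberTheory.Automorphic.UnitaryGroup Literature.NumberTheory.GaloisRepresentations AdelicGroupData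
open Literature.NumberTheory.Automorphic.Arthur2013.Leaves.TECR Literature.NumberTheory.Rogawski1990
open Summit.HodgeConjecture.HodgeConjecture.Cruxes.H413.K2E1BorelEisensteinU
open Summit.HodgeConjecture.HodgeConjecture.Cruxes.H413.K2E1CharacterEisensteinU3PairDefs
open Summit.HodgeConjecture.HodgeConjecture.Cruxes.H413.K2E1ChiSectionSpaceU3PairDefs
open ContRepresentation
open scoped ENNReal NNReal

namespace Summit.HodgeConjecture.HodgeConjecture.R90.S8

variable (L : Type) [Field L] [NumberField L] [IsCMField L]

/-! ## §0 Two bookkeeping identities for right translation (★ `AdelicGroupData.rightTranslation`, `r(h)φ = φ(·h)`) -/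

/-- `r(x·y)φ = r(x)(r(y)φ)` (right translation is a representation; pointwise `φ(g·(x·y)) = φ((g·x)·y)`). [cite: BorelJacquet1979, §1.3] -/
theorem rightTranslation_mul_apply (x y : (quasiSplit (↥(maximalRealSubfield L)) L (IsCMField.complexConj L) 3).Adelic)
    (φ : (quasiSplit (↥(maximalRealSubfield L)) L (IsCMField.complexConj L) 3).Adelic → ℂ) :
    rightTranslation (quasiSplit (↥(maximalRealSubfield L)) L (IsCMField.complexConj L) 3) (x * y) φ =
      rightTranslation (quasiSplit (↥(maximalRealSubfield L)) L (IsCMField.complexConj L) 3) x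
        (rightTranslation (quasiSplit (↥(maximalRealSubfield L)) L (IsCMField.complexConj L) 3) y φ) := by
  funext g
  simp only [rightTranslation_apply, mul_assoc]

/-- `r(x)φ = r(y)φ` whenever `x = y·u` and `φ` is right-`u`-invariant (`r(u)φ = φ`). [cite: BorelJacquet1979, §4.2] -/
theorem rightTranslation_eq_of_eq_mul {x y u : (quasiSplit (↥(maximalRealSubfield L)) L (IsCMField.complexConj L) 3).Adelic} (h : x = y * u)
    {φ : (quasiSplit (↥(maximalRealSubfield L)) L (IsCMField.complexConj L) 3).Adelic → ℂ}
    (hu : rightTranslation (quasiSplit (↥(maximalRealSubfield L)) L (IsCMField.complexConj L) 3) u φ = φ) :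
    rightTranslation (quasiSplit (↥(maximalRealSubfield L)) L (IsCMField.complexConj L) 3) x φ =
      rightTranslation (quasiSplit (↥(maximalRealSubfield L)) L (IsCMField.complexConj L) 3) y φ := by
  rw [h, rightTranslation_mul_apply, hu]

/-! ## §1 L-ARCH: sections at a level containing `ι(K_∞)` are `K_∞`-eigensections, hence arch-finite; the level of record contains `ι(K_∞)` -/

section Arch

variable {χ₁ : HeckeCharacter L} {χ₂ : ↥(TorusDict.torus (IsCMField.complexConj L)) →ₜ* ℂˣ}
  {K' : Subgroup (quasiSplit (↥(maximalRealSubfield L)) L (IsCMField.complexConj L) 3).Adelic} {ω : ↥K' → ℂ}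
  {φ : (quasiSplit (↥(maximalRealSubfield L)) L (IsCMField.complexConj L) 3).Adelic → ℂ}

/-- **`r(k)φ = ω(k)·φ`** for `φ ∈ V(χ₁, χ₂; K′, ω)` and `k ∈ K′` — a section is an eigenvector of its own level. [cite: MoeglinWaldspurger1995, I.2.17] -/
theorem rightTranslation_eq_smul_of_mem (hφ : φ ∈ chiSectionSpacePair χ₁ χ₂ K' ω) (k : ↥K') :
    rightTranslation (quasiSplit (↥(maximalRealSubfield L)) L (IsCMField.complexConj L) 3) (k : (quasiSplit (↥(maximalRealSubfield L)) L (IsCMField.complexConj L) 3).Adelic) φ = ω k • φ := by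
  funext g
  rw [rightTranslation_apply, Pi.smul_apply, smul_eq_mul]
  exact apply_mul_of_mem hφ g k

/-- **L-ARCH, GENERIC — `archTranslateSpan φ ≤ ℂ·φ`** when the level `K′` contains `ι(K_∞) = archMaximalCompact` (`hK`): every `K_∞`-translate of `φ ∈ V(χ₁, χ₂; K′, ω)` is the scalar
multiple `ω(k)·φ`. [cite: BorelJacquet1979, §4.2] [cite: MoeglinWaldspurger1995, I.2.17] -/
theorem archTranslateSpan_le_span_singleton_of_archMaximalCompact_le (hK : archMaximalCompact L ≤ K') (hφ : φ ∈ chiSectionSpacePair χ₁ χ₂ K' ω) :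
    archTranslateSpan L φ ≤ ℂ ∙ φ := by
  rw [archTranslateSpan_def]
  refine Submodule.span_le.2 ?_
  rintro _ ⟨k, rfl⟩
  dsimp only
  rw [SetLike.mem_coe, rightTranslation_eq_smul_of_mem L hφ ⟨(k : (quasiSplit (↥(maximalRealSubfield L)) L (IsCMField.complexConj L) 3).Adelic), hK k.2⟩]
  exact Submodule.smul_mem _ _ (Submodule.mem_span_singleton_self φ)

/-- **L-ARCH, GENERIC — A SECTION AT A LEVEL CONTAINING `ι(K_∞)` IS ARCH-FINITE** (`dim archTranslateSpan φ ≤ 1`). [cite: BorelJacquet1979, §4.2] [cite: WallachRRG1, §3.3.1] -/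
theorem isArchFinite_of_archMaximalCompact_le (hK : archMaximalCompact L ≤ K') (hφ : φ ∈ chiSectionSpacePair χ₁ χ₂ K' ω) : IsArchFinite L φ := by
  rw [isArchFinite_iff]
  exact Submodule.finiteDimensional_of_le (archTranslateSpan_le_span_singleton_of_archMaximalCompact_le L hK hφ)

/-- **`ι(K_∞) ≤ levelOfRecord K_f`**: the level of record `{k ∈ K | k_f ∈ K_f}` contains the archimedean maximal compact (`(ι a)_f = 1 ∈ K_f`, ★ `archToAdelic_mem_levelOfRecord`).
[cite: BorelJacquet1979, §4.1] -/
theorem archMaximalCompact_le_levelOfRecord (Kf : Subgroup ↥(finAdelic (↥(maximalRealSubfield L)) L (IsCMField.complexConj L) 3 ((StdForm.antidiagonal 3).over L))) :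
    archMaximalCompact L ≤ levelOfRecord L Kf := by
  rintro k ⟨hk, a, rfl⟩
  exact archToAdelic_mem_levelOfRecord L Kf a hk

/-- **L-ARCH AT THE LEVEL OF RECORD — `isArchFinite_of_mem_chiSectionSpacePair_levelOfRecord`**: every section `φ ∈ V(χ₁, χ₂; levelOfRecord K_f, ω)` (ANY right function `ω`, in particular ★
`omegaOfRecord χ₁ χ₂ K_f`) is arch-finite — its `ι(K_∞)`-translate span is the line `ℂ·φ` (the ONE-DIMENSIONAL `K_∞`-type sections of record, ★ p863976, qualify for τ-admissibility).
[cite: BorelJacquet1979, §4.2] [cite: MoeglinWaldspurger1995, I.2.17] [cite: WallachRRG1, §3.3.1] -/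
theorem isArchFinite_of_mem_chiSectionSpacePair_levelOfRecord {Kf : Subgroup ↥(finAdelic (↥(maximalRealSubfield L)) L (IsCMField.complexConj L) 3 ((StdForm.antidiagonal 3).over L))}
    {ω : ↥(levelOfRecord L Kf) → ℂ} (hφ : φ ∈ chiSectionSpacePair χ₁ χ₂ (levelOfRecord L Kf) ω) : IsArchFinite L φ :=
  isArchFinite_of_archMaximalCompact_le L (archMaximalCompact_le_levelOfRecord L Kf) hφ

/-- The line form at the level of record: `archTranslateSpan φ ≤ ℂ·φ`. [cite: BorelJacquet1979, §4.2] -/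
theorem archTranslateSpan_le_span_singleton_of_mem_chiSectionSpacePair_levelOfRecord
    {Kf : Subgroup ↥(finAdelic (↥(maximalRealSubfield L)) L (IsCMField.complexConj L) 3 ((StdForm.antidiagonal 3).over L))}
    {ω : ↥(levelOfRecord L Kf) → ℂ} (hφ : φ ∈ chiSectionSpacePair χ₁ χ₂ (levelOfRecord L Kf) ω) : archTranslateSpan L φ ≤ ℂ ∙ φ :=
  archTranslateSpan_le_span_singleton_of_archMaximalCompact_le L (archMaximalCompact_le_levelOfRecord L Kf) hφ

end Arch

/-! ## §2 L-GEN→τ: ★ D1 generators at a level `(K′, ω)` with `ι(K_∞) ≤ K′` and `ω = 1` on `ι_f(U₀) ≤ K′` are τ-admissible generators at `U₀` -/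

section GenTau

variable {χ₁ : HeckeCharacter L} {χ₂ : ↥(TorusDict.torus (IsCMField.complexConj L)) →ₜ* ℂˣ}
  {K' : Subgroup (quasiSplit (↥(maximalRealSubfield L)) L (IsCMField.complexConj L) 3).Adelic}
  {U₀ : Subgroup ↥(finAdelic (↥(maximalRealSubfield L)) L (IsCMField.complexConj L) 3 ((StdForm.antidiagonal 3).over L))}

/-- **RE-LEVELLING A SECTION TO A τ-LEVEL**: if `ω = 1` on `ι_f(U₀) ≤ K′` (`hU`, the OF-RECORD files' binder shape) then `V(χ₁, χ₂; K′, ω) ≤ V(χ₁, χ₂; tauLevel U₀, 1)` — the Borel law is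
unchanged and `φ(g·ι_f b) = ω(ι_f b)·φ(g) = φ(g)` for `b ∈ U₀`. [cite: MoeglinWaldspurger1995, I.2.17] [cite: BorelJacquet1979, §4.2] -/
theorem chiSectionSpacePair_le_tauLevel {ω : ↥K' → ℂ}
    (hU : ∀ b ∈ U₀, ∃ hb : finAdelicToAdelic (↥(maximalRealSubfield L)) L (IsCMField.complexConj L) 3 ((StdForm.antidiagonal 3).over L) b ∈ K', ω ⟨_, hb⟩ = 1) :
    chiSectionSpacePair χ₁ χ₂ K' ω ≤ chiSectionSpacePair χ₁ χ₂ (tauLevel L U₀) ((1 : ↥(tauLevel L U₀) →* ℂ) : ↥(tauLevel L U₀) → ℂ) := by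
  intro φ hφ
  refine mem_chiSectionSpacePair (isChiSectionPair_of_mem hφ) fun g k => ?_
  obtain ⟨b, hb, hbk⟩ := (mem_tauLevel_iff L U₀ (k : (quasiSplit (↥(maximalRealSubfield L)) L (IsCMField.complexConj L) 3).Adelic)).1 k.2
  obtain ⟨hbK, hω⟩ := hU b hb
  have h := apply_mul_of_mem hφ g ⟨_, hbK⟩
  rw [hω, one_mul] at h
  rw [MonoidHom.one_apply, one_mul, ← hbk]
  exact h

variable (μ : Measure (quasiSplit (↥(maximalRealSubfield L)) L (IsCMField.complexConj L) 3).automorphicQuotient) (ξ : OneDimAutRepH L) (μω : HeckeCharacter L)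

/-- **L-GEN→τ — `resGMidAtomGen ξ μω K′ ω ⊆ resGMidAtomGenτ ξ μω U₀`** whenever `ι(K_∞) ≤ K′` (`hKinf`) and `ω = 1` on `ι_f(U₀) ≤ K′` (`hU`): the generating section `φ` is re-levelled to
`(tauLevel U₀, 1)` (`chiSectionSpacePair_le_tauLevel`), it is arch-finite by §1 (`isArchFinite_of_archMaximalCompact_le`), and the continuation `Ec`, the pole set `Sp`, the pole letter `Fp`
and the a.e. identity are carried BYTE FOR BYTE. [cite: Rogawski1990, §13.9 p. 229 (ii)] [cite: MoeglinWaldspurger1995, I.2.17, IV.1.11] -/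
theorem resGMidAtomGen_subset_resGMidAtomGenτ {ω : ↥K' →* ℂ} (hKinf : archMaximalCompact L ≤ K')
    (hU : ∀ b ∈ U₀, ∃ hb : finAdelicToAdelic (↥(maximalRealSubfield L)) L (IsCMField.complexConj L) 3 ((StdForm.antidiagonal 3).over L) b ∈ K', ω ⟨_, hb⟩ = 1) :
    resGMidAtomGen L μ ξ μω K' ω ⊆ resGMidAtomGenτ L μ ξ μω U₀ :=
  fun _ ⟨φ, hφ, hc, Ec, Sp, hSp, hEc, hEis, Fp, hFp, hres, hae⟩ =>
    ⟨φ, chiSectionSpacePair_le_tauLevel L hU hφ, hc, isArchFinite_of_archMaximalCompact_le L hKinf hφ, Ec, Sp, hSp, hEc, hEis, Fp, hFp, hres, hae⟩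

/-- **`resGMidAtom ξ μω K′ ω ≤ resGMidAtomτ ξ μω U₀`** under `hKinf`, `hU` (closure ∘ span of the previous inclusion). [cite: Rogawski1990, §13.9 p. 229 (ii)] [cite: MoeglinWaldspurger1995, V.3.13] -/
theorem resGMidAtom_le_resGMidAtomτ {ω : ↥K' →* ℂ} (hKinf : archMaximalCompact L ≤ K')
    (hU : ∀ b ∈ U₀, ∃ hb : finAdelicToAdelic (↥(maximalRealSubfield L)) L (IsCMField.complexConj L) 3 ((StdForm.antidiagonal 3).over L) b ∈ K', ω ⟨_, hb⟩ = 1) :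
    resGMidAtom L μ ξ μω K' ω ≤ resGMidAtomτ L μ ξ μω U₀ := by
  rw [resGMidAtom_def, resGMidAtomτ_def]
  exact Submodule.topologicalClosure_mono (Submodule.span_mono (resGMidAtomGen_subset_resGMidAtomGenτ L μ ξ μω hKinf hU))

/-- **`resGMidAtom ξ μω K′ ω ≤ resGMidBlockτ ξ μω`** under `hKinf`, `hU` at a τ-ADMISSIBLE `U₀` (`IsTauLevel U₀`; ★ `resGMidAtomτ_le_resGMidBlockτ`). [cite: Rogawski1990, §13.9 p. 229 (ii)]
[cite: MoeglinWaldspurger1995, II.1, V.3.13] -/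
theorem resGMidAtom_le_resGMidBlockτ [(quasiSplit (↥(maximalRealSubfield L)) L (IsCMField.complexConj L) 3).IsAutomorphicMeasure μ] {ω : ↥K' →* ℂ}
    (hKinf : archMaximalCompact L ≤ K') (hU₀ : IsTauLevel L U₀)
    (hU : ∀ b ∈ U₀, ∃ hb : finAdelicToAdelic (↥(maximalRealSubfield L)) L (IsCMField.complexConj L) 3 ((StdForm.antidiagonal 3).over L) b ∈ K', ω ⟨_, hb⟩ = 1) :
    resGMidAtom L μ ξ μω K' ω ≤ (resGMidBlockτ L μ ξ μω).toSubmodule :=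
  (resGMidAtom_le_resGMidAtomτ L μ ξ μω hKinf hU).trans (resGMidAtomτ_le_resGMidBlockτ L μ ξ μω hU₀)

/-! ### §2′ At the level of record `(levelOfRecord K_f, ω₀)`, `ω₀ = omegaOfRecord χ₁′ χ₂′ K_f` pointwise, any `U₀ ≤ K_f ≤ G(𝒪̂)_f` -/

variable {Kf : Subgroup ↥(finAdelic (↥(maximalRealSubfield L)) L (IsCMField.complexConj L) 3 ((StdForm.antidiagonal 3).over L))}

/-- Transport of the `hU` binder along a pointwise identity of right characters. [folklore] -/
theorem hU_congr {K'' : Subgroup (quasiSplit (↥(maximalRealSubfield L)) L (IsCMField.complexConj L) 3).Adelic} {ω₀ : ↥K'' →* ℂ} {ω₁ : ↥K'' → ℂ} (hω₀ : ∀ k, ω₀ k = ω₁ k)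
    {U₁ : Subgroup ↥(finAdelic (↥(maximalRealSubfield L)) L (IsCMField.complexConj L) 3 ((StdForm.antidiagonal 3).over L))}
    (hU : ∀ b ∈ U₁, ∃ hb : finAdelicToAdelic (↥(maximalRealSubfield L)) L (IsCMField.complexConj L) 3 ((StdForm.antidiagonal 3).over L) b ∈ K'', ω₁ ⟨_, hb⟩ = 1) :
    ∀ b ∈ U₁, ∃ hb : finAdelicToAdelic (↥(maximalRealSubfield L)) L (IsCMField.complexConj L) 3 ((StdForm.antidiagonal 3).over L) b ∈ K'', ω₀ ⟨_, hb⟩ = 1 := fun b hb => by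
  obtain ⟨hbK, h1⟩ := hU b hb
  exact ⟨hbK, by rw [hω₀, h1]⟩

/-- **`hU` AT THE LEVEL OF RECORD**: for `K_f ≤ G(𝒪̂)_f`, a right character `ω₀ : levelOfRecord K_f →* ℂ` agreeing pointwise with ★ `omegaOfRecord χ₁′ χ₂′ K_f`, and ANY `U₀ ≤ K_f`: every `b ∈ U₀`
has `ι_f b ∈ levelOfRecord K_f` and `ω₀(ι_f b) = Φa((ι_f b)_∞) = Φa(1) = 1` (★ `exists_mem_levelOfRecord_omegaOfRecord_eq_one`). [cite: BorelJacquet1979, §4.1] -/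
theorem hU_levelOfRecord (χ₁' : HeckeCharacter L) (χ₂' : ↥(TorusDict.torus (IsCMField.complexConj L)) →ₜ* ℂˣ)
    (hKf : Kf ≤ finAdelicIntegralLevel (↥(maximalRealSubfield L)) L (IsCMField.complexConj L) 3 ((StdForm.antidiagonal 3).over L))
    (ω₀ : ↥(levelOfRecord L Kf) →* ℂ) (hω₀ : ∀ k, ω₀ k = omegaOfRecord L χ₁' χ₂' Kf k) (hU₀ : U₀ ≤ Kf) :
    ∀ b ∈ U₀, ∃ hb : finAdelicToAdelic (↥(maximalRealSubfield L)) L (IsCMField.complexConj L) 3 ((StdForm.antidiagonal 3).over L) b ∈ levelOfRecord L Kf, ω₀ ⟨_, hb⟩ = 1 :=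
  hU_congr L hω₀ fun _ hb => exists_mem_levelOfRecord_omegaOfRecord_eq_one L χ₁' χ₂' hKf (hU₀ hb)

/-- **`mem_resGMidAtomGenτ_of_mem_resGMidAtomGen_levelOfRecord` — A GENERATOR AT THE LEVEL OF RECORD IS A τ-ADMISSIBLE GENERATOR** at every `U₀ ≤ K_f` (`K_f ≤ G(𝒪̂)_f`; right character
`ω₀ = omegaOfRecord χ₁′ χ₂′ K_f` pointwise): the 1-dim `K_∞`-type atoms of record feed the τ-atoms. [cite: Rogawski1990, §13.9 p. 229 (ii)] [cite: MoeglinWaldspurger1995, I.2.17, IV.1.11] -/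
theorem mem_resGMidAtomGenτ_of_mem_resGMidAtomGen_levelOfRecord (χ₁' : HeckeCharacter L) (χ₂' : ↥(TorusDict.torus (IsCMField.complexConj L)) →ₜ* ℂˣ)
    (hKf : Kf ≤ finAdelicIntegralLevel (↥(maximalRealSubfield L)) L (IsCMField.complexConj L) 3 ((StdForm.antidiagonal 3).over L))
    (ω₀ : ↥(levelOfRecord L Kf) →* ℂ) (hω₀ : ∀ k, ω₀ k = omegaOfRecord L χ₁' χ₂' Kf k) (hU₀ : U₀ ≤ Kf)
    {f : (quasiSplit (↥(maximalRealSubfield L)) L (IsCMField.complexConj L) 3).L2 μ} (hf : f ∈ resGMidAtomGen L μ ξ μω (levelOfRecord L Kf) ω₀) :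
    f ∈ resGMidAtomGenτ L μ ξ μω U₀ :=
  resGMidAtomGen_subset_resGMidAtomGenτ L μ ξ μω (archMaximalCompact_le_levelOfRecord L Kf) (hU_levelOfRecord L χ₁' χ₂' hKf ω₀ hω₀ hU₀) hf

/-- **`resGMidAtom_levelOfRecord_le_resGMidAtomτ` — «1-DIM ATOMS ⊆ τ-ATOMS»**: `resGMidAtom ξ μω (levelOfRecord K_f) ω₀ ≤ resGMidAtomτ ξ μω U₀` for `U₀ ≤ K_f ≤ G(𝒪̂)_f`, `ω₀ = omegaOfRecord χ₁′ χ₂′ K_f`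
pointwise. [cite: Rogawski1990, §13.9 p. 229 (ii)] [cite: MoeglinWaldspurger1995, V.3.13] -/
theorem resGMidAtom_levelOfRecord_le_resGMidAtomτ (χ₁' : HeckeCharacter L) (χ₂' : ↥(TorusDict.torus (IsCMField.complexConj L)) →ₜ* ℂˣ)
    (hKf : Kf ≤ finAdelicIntegralLevel (↥(maximalRealSubfield L)) L (IsCMField.complexConj L) 3 ((StdForm.antidiagonal 3).over L))
    (ω₀ : ↥(levelOfRecord L Kf) →* ℂ) (hω₀ : ∀ k, ω₀ k = omegaOfRecord L χ₁' χ₂' Kf k) (hU₀ : U₀ ≤ Kf) :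
    resGMidAtom L μ ξ μω (levelOfRecord L Kf) ω₀ ≤ resGMidAtomτ L μ ξ μω U₀ :=
  resGMidAtom_le_resGMidAtomτ L μ ξ μω (archMaximalCompact_le_levelOfRecord L Kf) (hU_levelOfRecord L χ₁' χ₂' hKf ω₀ hω₀ hU₀)

/-- **`resGMidAtom_levelOfRecord_le_resGMidBlockτ`**: the atom at the level of record lies in the τ-BLOCK as soon as SOME τ-admissible `U₀ ≤ K_f` exists (e.g. `U₀ := K(𝔫)_f` itself: ★
`isOpen_finCongruenceLevel`, ★ `isCompact_finCongruenceLevel`, ★ `finCongruenceLevel_le_integralLevel`). [cite: Rogawski1990, §13.9 p. 229 (ii)] [cite: MoeglinWaldspurger1995, II.1, V.3.13] -/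
theorem resGMidAtom_levelOfRecord_le_resGMidBlockτ [(quasiSplit (↥(maximalRealSubfield L)) L (IsCMField.complexConj L) 3).IsAutomorphicMeasure μ]
    (χ₁' : HeckeCharacter L) (χ₂' : ↥(TorusDict.torus (IsCMField.complexConj L)) →ₜ* ℂˣ)
    (hKf : Kf ≤ finAdelicIntegralLevel (↥(maximalRealSubfield L)) L (IsCMField.complexConj L) 3 ((StdForm.antidiagonal 3).over L))
    (ω₀ : ↥(levelOfRecord L Kf) →* ℂ) (hω₀ : ∀ k, ω₀ k = omegaOfRecord L χ₁' χ₂' Kf k) (hU₀ : U₀ ≤ Kf) (hU₀τ : IsTauLevel L U₀) :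
    resGMidAtom L μ ξ μω (levelOfRecord L Kf) ω₀ ≤ (resGMidBlockτ L μ ξ μω).toSubmodule :=
  resGMidAtom_le_resGMidBlockτ L μ ξ μω (archMaximalCompact_le_levelOfRecord L Kf) hU₀τ (hU_levelOfRecord L χ₁' χ₂' hKf ω₀ hω₀ hU₀)

end GenTau

end Summit.HodgeConjecture.HodgeConjecture.R90.S8

end
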